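import Literature.Analysis.FluidPDE.LerayHopfProofs
import Literature.Analysis.FluidPDE.PassiveScalarForced
import Literature.Analysis.FunctionSpaces.TorusAxisAverage
import Literature.Analysis.FunctionSpaces.TorusTestFunction
import HarnessLib

/-!
# The datum of a Leray–Hopf solution on the flat torus: measurability dichotomy, honest
  representatives, and re-basing of the weak formulations at the time `t = 0`

Analysis/FluidPDE support file (theorem-only). The datum `u₀` of the accepted
`Torus.IsLerayHopfOn T ν f u₀ u` is an arbitrary function entering only through Bochner pairings
`∫ ⟪u₀, w⟫` (weak formulation, weak `L²`-continuity) and through `eLpNorm (u t - u₀) 2`; it need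
not be a.e. strongly measurable. This file gives the torus twins of the whole-space bookkeeping
of `Literature/Analysis/FluidPDE/LerayHopfProofs` (`IsLerayHopfOn.aestronglyMeasurable_datum_or`
and its companions) and the consequences used by the `2½`-dimensional reduction of route
`AnomalousDissipation/TwoAndHalfD`:

* `Torus.IsLerayHopfOn.integral_inner_datum_add`, `…_eq_zero`,
  `Torus.aestronglyMeasurable_of_forall_integrable_inner`,
  `Torus.IsLerayHopfOn.aestronglyMeasurable_datum_or` — either `u₀` is a.e. strongly measurable,
  or the datum functional `w ↦ ∫ ⟪u₀, w⟫` vanishes on `L²`;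
* `Torus.IsLerayHopfOn.datum_comp_add_single_ae_eq` — if every slice `u t` is invariant under the
  translations along a coordinate axis, a measurable datum is a.e. invariant, hence
  (`Torus.IsLerayHopfOn.exists_invariant_datum`; a measurable datum is in `L²` as in the whole-space
  `IsLerayHopfOn.memLp_two_datum`) **every** Leray–Hopf solution with invariant slices has an
  everywhere-invariant datum `U₀ ∈ L²` with the same pairings
  `∫ ⟪u₀, w⟫ = ∫ ⟪U₀, w⟫` on `L²` (the axis average `Torus.axisAvg` of `u₀`, or `0` in the
  degenerate branch);
* `Torus.IsWeakNSSolutionForcedOn.congr_datum_of_forall_integral_inner_eq` — re-basing the weak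
  formulation to such a datum; `Torus.IsWeakNSSolutionForcedOn.congr_of_eqOn_Ioo`,
  `Torus.IsWeakScalarTransportForcedOn.congr_velocity_of_eqOn_Ioo` — the weak formulations do
  not see the velocity off the open time interval `(0, T)` (so a solution may be re-defined at
  `t = 0`).

## References

* J. Leray, Acta Math. 63 (1934), §III; G. P. Galdi (2000), Def. 2.1 (the datum clauses).
* A. J. Majda, A. L. Bertozzi, *Vorticity and Incompressible Flow* (CUP 2002), §2.3.1 (axis
  averages of `x₃`-independent flows).
-/

noncomputable section

open MeasureTheory TopologicalSpace Set Function Filter Topology UnitAddTorus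
open scoped InnerProductSpace RealInnerProductSpace ENNReal NNReal

namespace Literature.Analysis.FluidPDE

namespace Torus

variable {d : Type*} [Fintype d] [DecidableEq d]

variable {T ν : ℝ} {f u : ℝ → UnitAddTorus d → EuclideanSpace ℝ d}
  {u₀ : UnitAddTorus d → EuclideanSpace ℝ d}

/-! ### The datum functional: additivity and the measurability dichotomy -/

/-- **The datum pairing is additive on `L²`** (torus twin of
`Literature.Analysis.FluidPDE.IsLerayHopfOn.integral_inner_datum_add`): the pairings
`w ↦ ∫ ⟪u₀, w⟫` are limits as `t → 0⁺` of the honest pairings `∫ ⟪u(t), w⟫`. [folklore] -/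
theorem IsLerayHopfOn.integral_inner_datum_add (h : IsLerayHopfOn T ν f u₀ u) (hT : 0 < T)
    {w w' : UnitAddTorus d → EuclideanSpace ℝ d} (hw : MemLp w 2 volume) (hw' : MemLp w' 2 volume) :
    ∫ x, ⟪u₀ x, (w + w') x⟫ = (∫ x, ⟪u₀ x, w x⟫) + ∫ x, ⟪u₀ x, w' x⟫ := by
  have h1 := (h.weak_continuous w hw).2
  have h2 := (h.weak_continuous w' hw').2
  have h12 := (h.weak_continuous (w + w') (hw.add hw')).2
  refine tendsto_nhds_unique h12 ((h1.add h2).congr' ?_)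
  have hev : ∀ᶠ t in 𝓝[>] (0 : ℝ), t ∈ Ioo 0 T := Ioo_mem_nhdsGT hT
  filter_upwards [hev] with t ht
  have hut : MemLp (u t) 2 volume := h.memLp t (Ioo_subset_Icc_self ht)
  rw [← integral_add (integrable_inner_of_memLp_two hut hw)
    (integrable_inner_of_memLp_two hut hw')]
  refine integral_congr_ae (Eventually.of_forall fun x => ?_)
  simp only [Pi.add_apply, inner_add_right]

/-- **A non-integrable pairing kills the datum functional** (torus twin of
`Literature.Analysis.FluidPDE.IsLerayHopfOn.integral_inner_datum_eq_zero`). [folklore] -/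
theorem IsLerayHopfOn.integral_inner_datum_eq_zero (h : IsLerayHopfOn T ν f u₀ u) (hT : 0 < T)
    {v : UnitAddTorus d → EuclideanSpace ℝ d} (hv : MemLp v 2 volume)
    (hnv : ¬ Integrable (fun x => ⟪u₀ x, v x⟫) volume)
    {w : UnitAddTorus d → EuclideanSpace ℝ d} (hw : MemLp w 2 volume) : ∫ x, ⟪u₀ x, w x⟫ = 0 := by
  by_cases hiw : Integrable (fun x => ⟪u₀ x, w x⟫) volume
  · have hadd := h.integral_inner_datum_add hT hw hv
    have hnot : ¬ Integrable (fun x => ⟪u₀ x, (w + v) x⟫) volume := by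
      intro hi
      refine hnv ((hi.sub hiw).congr (Eventually.of_forall fun x => ?_))
      simp only [Pi.add_apply, inner_add_right, Pi.sub_apply, add_sub_cancel_left]
    rw [integral_undef hnot, integral_undef hnv, add_zero] at hadd
    exact hadd.symm
  · exact integral_undef hiw

omit [DecidableEq d] in
/-- **Measurability test through `L²` pairings on the torus**: if every pairing `x ↦ ⟪u₀ x, w x⟫`
with `w ∈ L²` is integrable, then `u₀` is a.e. strongly measurable (test with the constant fields
of an orthonormal basis; the torus has finite volume). [folklore] -/
theorem aestronglyMeasurable_of_forall_integrable_inner {u₀ : UnitAddTorus d → EuclideanSpace ℝ d}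
    (h : ∀ w : UnitAddTorus d → EuclideanSpace ℝ d, MemLp w 2 volume → Integrable (fun x => ⟪u₀ x, w x⟫) volume) :
    AEStronglyMeasurable u₀ volume := by
  set b := stdOrthonormalBasis ℝ (EuclideanSpace ℝ d) with hb
  have hcoord : ∀ i, AEStronglyMeasurable (fun x => ⟪u₀ x, b i⟫) volume := fun i =>
    (h (fun _ => b i) (memLp_const (b i))).aestronglyMeasurable
  have heq : u₀ = fun x => ∑ i, ⟪u₀ x, b i⟫ • b i := by
    funext x
    conv_lhs => rw [← b.sum_repr (u₀ x)]
    refine Finset.sum_congr rfl fun i _ => ?_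
    rw [OrthonormalBasis.repr_apply_apply, real_inner_comm]
  rw [heq]
  exact Finset.aestronglyMeasurable_fun_sum _ fun i _ => (hcoord i).smul_const (b i)

/-- **The dichotomy for the datum of a Leray–Hopf solution on the torus** (`T > 0`): either `u₀`
is a.e. strongly measurable, or the datum functional vanishes identically on `L²`. [folklore] -/
theorem IsLerayHopfOn.aestronglyMeasurable_datum_or (h : IsLerayHopfOn T ν f u₀ u) (hT : 0 < T) :
    AEStronglyMeasurable u₀ volume ∨
      ∀ w : UnitAddTorus d → EuclideanSpace ℝ d, MemLp w 2 volume → ∫ x, ⟪u₀ x, w x⟫ = 0 := by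
  by_cases hall : ∀ w : UnitAddTorus d → EuclideanSpace ℝ d, MemLp w 2 volume →
      Integrable (fun x => ⟪u₀ x, w x⟫) volume
  · exact Or.inl (aestronglyMeasurable_of_forall_integrable_inner hall)
  · push Not at hall
    obtain ⟨v, hv, hnv⟩ := hall
    exact Or.inr fun w hw => h.integral_inner_datum_eq_zero hT hv hnv hw

/-! ### Invariant slices have an invariant datum -/

/-- **A measurable datum of a solution with invariant slices is a.e. invariant.** If every slice
`u t` is invariant under the translations `x ↦ x + s eᵢ` along the `i`-th axis and `u₀` is a.e.
strongly measurable, then `u₀ ∘ (· + s eᵢ) = u₀` a.e. for every `s`: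
`‖u₀(· + s eᵢ) - u₀‖₂ ≤ 2‖u(t) - u₀‖₂ → 0` (the translation preserves the measure). [folklore] -/
theorem IsLerayHopfOn.datum_comp_add_single_ae_eq (h : IsLerayHopfOn T ν f u₀ u) (hT : 0 < T)
    (hu₀ : AEStronglyMeasurable u₀ volume) {i : d}
    (hinv : ∀ (t : ℝ) (s : UnitAddCircle) (x : UnitAddTorus d), u t (x + Pi.single i s) = u t x)
    (s : UnitAddCircle) :
    (fun x => u₀ (x + Pi.single i s)) =ᵐ[volume] u₀ := by
  set τ : UnitAddTorus d → UnitAddTorus d := fun x => x + (Pi.single i s : UnitAddTorus d) with hτ_def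
  have hτ : MeasurePreserving τ volume volume := FunctionSpaces.Torus.measurePreserving_add_single i s
  set g : UnitAddTorus d → EuclideanSpace ℝ d := fun x => u₀ (τ x) - u₀ x with hg
  have hu₀τ : AEStronglyMeasurable (u₀ ∘ τ) volume := hu₀.comp_measurePreserving hτ
  have hgm : AEStronglyMeasurable g volume := hu₀τ.sub hu₀
  -- `‖g‖₂ ≤ 2 ‖u(t) - u₀‖₂` for every `t`
  have hbound : ∀ t ∈ Ioo 0 T, eLpNorm g 2 volume ≤ 2 * eLpNorm (u t - u₀) 2 volume := by
    intro t ht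
    have hut : MemLp (u t) 2 volume := h.memLp t (Ioo_subset_Icc_self ht)
    have hdm : AEStronglyMeasurable (u t - u₀) volume := hut.1.sub hu₀
    have hsplit : g = (u t - u₀) - (u t - u₀) ∘ τ := by
      funext x
      have hx : u t (τ x) = u t x := hinv t s x
      simp only [hg, Pi.sub_apply, Function.comp_apply, hx]
      rw [sub_sub_sub_cancel_left]
    have hdmτ : AEStronglyMeasurable ((u t - u₀) ∘ τ) volume := hdm.comp_measurePreserving hτ
    have h1 : eLpNorm ((u t - u₀) ∘ τ) 2 volume = eLpNorm (u t - u₀) 2 volume :=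
      eLpNorm_comp_measurePreserving hdm hτ
    rw [hsplit]
    calc eLpNorm ((u t - u₀) - (u t - u₀) ∘ τ) 2 volume
        ≤ eLpNorm (u t - u₀) 2 volume + eLpNorm ((u t - u₀) ∘ τ) 2 volume := eLpNorm_sub_le hdm hdmτ one_le_two
      _ = 2 * eLpNorm (u t - u₀) 2 volume := by rw [h1, two_mul]
  -- let `t → 0⁺`
  have hlim : Tendsto (fun t => 2 * eLpNorm (u t - u₀) 2 volume) (𝓝[>] 0) (𝓝 0) := by
    have := ENNReal.Tendsto.const_mul h.strong_initial (Or.inr (ENNReal.ofNat_ne_top (n := 2)))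
    rwa [mul_zero] at this
  have hzero : eLpNorm g 2 volume = 0 := by
    refine le_antisymm (ge_of_tendsto hlim ?_) bot_le
    filter_upwards [Ioo_mem_nhdsGT hT] with t ht
    exact hbound t ht
  have hae := (eLpNorm_eq_zero_iff hgm two_ne_zero).1 hzero
  filter_upwards [hae] with x hx
  exact sub_eq_zero.1 hx

/-- **Every Leray–Hopf solution with invariant slices has an honest invariant datum**: for `u`
Leray–Hopf on `[0, T)`, `T > 0`, all of whose slices are invariant under the translations along
the `i`-th axis, there is `U₀ ∈ L²`, invariant at every point, with the same pairings as the
datum, `∫ ⟪u₀, w⟫ = ∫ ⟪U₀, w⟫` for every `w ∈ L²` — the axis average `Torus.axisAvg i u₀`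
(`axisAvg_ae_eq_of_forall_translate_ae_eq`) if `u₀` is measurable, `0` in the degenerate branch
of the dichotomy. [folklore] -/
theorem IsLerayHopfOn.exists_invariant_datum (h : IsLerayHopfOn T ν f u₀ u) (hT : 0 < T) {i : d}
    (hinv : ∀ (t : ℝ) (s : UnitAddCircle) (x : UnitAddTorus d), u t (x + Pi.single i s) = u t x) :
    ∃ U₀ : UnitAddTorus d → EuclideanSpace ℝ d, MemLp U₀ 2 volume ∧
      (∀ (s : UnitAddCircle) (x : UnitAddTorus d), U₀ (x + Pi.single i s) = U₀ x) ∧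
      ∀ w : UnitAddTorus d → EuclideanSpace ℝ d, MemLp w 2 volume → ∫ x, ⟪u₀ x, w x⟫ = ∫ x, ⟪U₀ x, w x⟫ := by
  rcases h.aestronglyMeasurable_datum_or hT with hm | h0
  · -- a measurable datum is square integrable: `u₀ = u(t) - (u(t) - u₀)`, `‖u(t) - u₀‖₂ < 1`
    have hu₀ : MemLp u₀ 2 volume := by
      have hev : ∀ᶠ t in 𝓝[>] (0 : ℝ), eLpNorm (u t - u₀) 2 volume < 1 :=
        h.strong_initial (Iio_mem_nhds zero_lt_one)
      obtain ⟨t, ht, htT⟩ := (hev.and (Ioo_mem_nhdsGT hT)).exists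
      have hut : MemLp (u t) 2 volume := h.memLp t (Ioo_subset_Icc_self htT)
      have hdiff : MemLp (u t - u₀) 2 volume := ⟨hut.1.sub hm, ht.trans ENNReal.one_lt_top⟩
      have := hut.sub hdiff
      simpa using this
    have hae : FunctionSpaces.Torus.axisAvg i u₀ =ᵐ[volume] u₀ :=
      FunctionSpaces.Torus.axisAvg_ae_eq_of_forall_translate_ae_eq (hu₀.integrable one_le_two)
        (h.datum_comp_add_single_ae_eq hT hm hinv)
    refine ⟨FunctionSpaces.Torus.axisAvg i u₀, hu₀.ae_eq hae.symm,
      fun s x => FunctionSpaces.Torus.axisAvg_add_single i u₀ s x, fun w _ => ?_⟩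
    exact integral_congr_ae (hae.mono fun x hx => by
      show ⟪u₀ x, w x⟫ = ⟪FunctionSpaces.Torus.axisAvg i u₀ x, w x⟫
      rw [hx])
  · refine ⟨0, MemLp.zero, fun _ _ => rfl, fun w hw => ?_⟩
    rw [h0 w hw]
    simp

/-! ### Re-basing the weak formulations -/

/-- **Re-basing the datum of the weak formulation**: if two data have the same pairings with all
`L²` fields, a forced weak solution with one datum is a forced weak solution with the other (the
datum enters only through `∫ ⟪u₀, ψ(0)⟫`, and `ψ(0) ∈ L²`). [folklore] -/
theorem IsWeakNSSolutionForcedOn.congr_datum_of_forall_integral_inner_eq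
    {U₀ : UnitAddTorus d → EuclideanSpace ℝ d} (hw : IsWeakNSSolutionForcedOn T ν f u₀ u)
    (h : ∀ w : UnitAddTorus d → EuclideanSpace ℝ d, MemLp w 2 volume → ∫ x, ⟪u₀ x, w x⟫ = ∫ x, ⟪U₀ x, w x⟫) :
    IsWeakNSSolutionForcedOn T ν f U₀ u := by
  obtain ⟨hm, hL2, hdiv, hweak⟩ := hw
  refine ⟨hm, hL2, hdiv, fun ψ hψ hψdiv => ?_⟩
  rw [← h (ψ 0) ((hψ.isSmooth_slice 0).memLp 2)]
  exact hweak ψ hψ hψdiv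

/-- **The weak Navier–Stokes formulation does not see the velocity off `(0, T)`**: if
`v t = u t` for every `t ∈ (0, T)`, a forced weak solution `u` is a forced weak solution `v`
(same datum and force). [folklore] -/
theorem IsWeakNSSolutionForcedOn.congr_of_eqOn_Ioo {v : ℝ → UnitAddTorus d → EuclideanSpace ℝ d}
    (hw : IsWeakNSSolutionForcedOn T ν f u₀ u) (hv : ∀ t ∈ Ioo 0 T, v t = u t) :
    IsWeakNSSolutionForcedOn T ν f u₀ v := by
  obtain ⟨hm, hL2, hdiv, hweak⟩ := hw
  have hae : ∀ᵐ p ∂(volume.restrict (Ioo 0 T ×ˢ (univ : Set (EuclideanSpace ℝ d)))),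
      FunctionSpaces.Torus.stLift v p = FunctionSpaces.Torus.stLift u p := by
    filter_upwards [ae_restrict_mem (measurableSet_Ioo.prod MeasurableSet.univ)] with p hp
    simp only [FunctionSpaces.Torus.stLift, hv p.1 hp.1]
  refine ⟨hm.congr (EventuallyEq.symm hae), ?_, ?_, fun ψ hψ hψdiv => ?_⟩
  · rw [setLIntegral_congr_fun measurableSet_Ioo (fun t ht => by rw [hv t ht])]
    exact hL2
  · filter_upwards [hdiv, ae_restrict_mem measurableSet_Ioo] with t ht htI
    rw [hv t htI]
    exact ht
  · have hI : (∫ t in Ioo 0 T, ∫ x, (⟪v t x, FunctionSpaces.Torus.timeDeriv ψ t x⟫ +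
        ⟪v t x, FunctionSpaces.Torus.convect (v t) (ψ t) x⟫ + ν * ⟪v t x, FunctionSpaces.Torus.laplacian (ψ t) x⟫ +
        ⟪f t x, ψ t x⟫)) =
        ∫ t in Ioo 0 T, ∫ x, (⟪u t x, FunctionSpaces.Torus.timeDeriv ψ t x⟫ +
          ⟪u t x, FunctionSpaces.Torus.convect (u t) (ψ t) x⟫ + ν * ⟪u t x, FunctionSpaces.Torus.laplacian (ψ t) x⟫ +
          ⟪f t x, ψ t x⟫) :=
      setIntegral_congr_fun measurableSet_Ioo fun t ht => by simp only [hv t ht]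
    rw [hI]
    exact hweak ψ hψ hψdiv

omit [DecidableEq d] in
/-- **The weak sourced scalar formulation does not see the drift off `(0, T)`**: if
`v t = u t` for every `t ∈ (0, T)`, a weak solution driven by `u` is a weak solution driven by
`v`. [folklore] -/
theorem IsWeakScalarTransportForcedOn.congr_velocity_of_eqOn_Ioo {κ : ℝ}
    {v : ℝ → UnitAddTorus d → EuclideanSpace ℝ d} {src : ℝ → UnitAddTorus d → ℝ}
    {θ₀ : UnitAddTorus d → ℝ} {θ : ℝ → UnitAddTorus d → ℝ}
    (h : IsWeakScalarTransportForcedOn T κ u src θ₀ θ) (hv : ∀ t ∈ Ioo 0 T, v t = u t) :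
    IsWeakScalarTransportForcedOn T κ v src θ₀ θ := by
  have hae : ∀ᵐ p ∂(volume.restrict (Ioo 0 T ×ˢ (univ : Set (EuclideanSpace ℝ d)))),
      FunctionSpaces.Torus.stLift v p = FunctionSpaces.Torus.stLift u p := by
    filter_upwards [ae_restrict_mem (measurableSet_Ioo.prod MeasurableSet.univ)] with p hp
    simp only [FunctionSpaces.Torus.stLift, hv p.1 hp.1]
  refine ⟨h.aestronglyMeasurable, h.aestronglyMeasurable_velocity.congr (EventuallyEq.symm hae),
    h.aestronglyMeasurable_source, h.ae_lintegral_sq_le, ?_, ?_, h.lintegral_source_lt_top, ?_, fun ψ hψ => ?_⟩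
  · rw [setLIntegral_congr_fun measurableSet_Ioo (fun t ht => by rw [hv t ht])]
    exact h.lintegral_velocity_lt_top
  · rw [setLIntegral_congr_fun measurableSet_Ioo (fun t ht => by rw [hv t ht])]
    exact h.lintegral_mul_lt_top
  · filter_upwards [h.ae_isWeaklyDivFree, ae_restrict_mem measurableSet_Ioo] with t ht htI
    rw [hv t htI]
    exact ht
  · have hI : (∫ t in Ioo 0 T, ∫ x, θ t x * (FunctionSpaces.Torus.timeDeriv ψ t x +
        ⟪v t x, FunctionSpaces.Torus.gradient (ψ t) x⟫_ℝ + κ * FunctionSpaces.Torus.laplacian (ψ t) x)) =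
        ∫ t in Ioo 0 T, ∫ x, θ t x * (FunctionSpaces.Torus.timeDeriv ψ t x +
          ⟪u t x, FunctionSpaces.Torus.gradient (ψ t) x⟫_ℝ + κ * FunctionSpaces.Torus.laplacian (ψ t) x) :=
      setIntegral_congr_fun measurableSet_Ioo fun t ht => by simp only [hv t ht]
    rw [hI]
    exact h.weak_eq ψ hψ

end Torus

end Literature.Analysis.FluidPDE

end
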